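import Literature.NumberTheory.GelbartRogawski1991.UnitaryDualPairThetaKernelCMTwist
import Literature.NumberTheory.Automorphic.UnitaryGroupAdelicDet
import Literature.NumberTheory.Automorphic.UnitaryGroupAdelicOneTorus
import Mathlib.Topology.Algebra.PontryaginDual
import HarnessLib

-- buildfix G11b-3 recipe (LEDGER B13-1/B13-3): elaborate sequentially so the trailing `attribute [implicit_reducible]`
-- block (reducibilityCoreExt is keyed to the async environment branch) is in force at `.olean` export.
set_option Elab.async false

/-!
# The normalising character of record `(χ_V ∘ det) ⊠ (χ_W ∘ det)` of the CM unitary dual pair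

[GelbartRogawski1991, §3.1 Remark p. 457 L4–13]: a compatible splitting of the metaplectic cover
over a unitary group `G(𝐀)` is unique up to `s ↦ s ⊗ ν′`, "where `ν′` is an automorphic character of
`E¹`, regarded as a character of `G`" (through `det : G → E¹ = U(1)_{E/F}`); for the dual pair
`U(V) × U(W)` the normalising datum is thus a pair of automorphic characters `χ_V, χ_W` of
`U(1)_{E/F}(𝔸_F)/U(1)(F)` entering as `(χ_V ∘ det_V) · (χ_W ∘ det_W)` (`CompatibleSplittingTwist`).
This file TYPES that character for the CM pair of `UnitaryDualPairThetaKernelCM` in the currency of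
`UnitaryDualPairThetaKernelCMTwist`:

* `cmAdelicDet L d hd0 : CMAdelic L d →* CMAdelicOne L` — `det : U(diag d)(𝔸_{L⁺}) → U(1)(𝔸_{L⁺})`
  (`UnitaryGroupAdelicDet` at the CM diagonal form, `det (diag d) = ∏ dᵢ ≠ 0`);
  `cmAdelicDet_center : det (u · 1_n) = u ^ n`;
* `cmDetTwistChar L dV hdV0 dW hdW0 χV χW : CMAdelic L dV × CMAdelic L dW →* ℂˣ`,
  `(g, h) ↦ χ_V(det g) · χ_W(det h)` — the `η` to feed `cmPairSplittingTwist` / `cmPairRepTwist`;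
* its three consumer obligations DISCHARGED from properties of `χ_V, χ_W` alone:
  `cmDetTwistChar_eq_one_of_principal` (the `hη` binder: trivial on rational points, from `χ`
  trivial on principal norm-one ideles), `continuous_cmDetTwistChar` (the `hηc` binder), and
  **`centerCharEq_cmDetTwistChar`**: on the anti-diagonal centre `(u · 1_V, u⁻¹ · 1_W)` the
  character is `χ_V(u)^N · χ_W(u)^{-M}` — i.e. `CenterCharEq L dV dW η (cmDetCenterChar L χV χW)`
  holds BY `rfl`-level algebra, so the acceptance test `CenterCharEq η β` of the K-type-normalised
  model [HarrisKudlaSweet1996, (1.14)–(1.15) p. 952] becomes the identity of `U(1)`-characters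
  `χ_V^N · χ_W^{-M} = β`;
* `§3`: the same with `χ` given on the idele-currency torus `relNormOneIdeles L⁺ L`
  (`UnitaryGroupAdelicOneTorus.cmAdelicOneEquivRelNormOne`); `§4`: with `χ` a continuous unitary
  character of the automorphic quotient `[U(1)] = relNormOneIdeles L⁺ L ⧸ relNormOneRat L⁺ L`
  (`charOfUnitaryLineChar`: automorphy and continuity are then automatic), the currency of the tree's
  existence theorem `Automorphic.exists_unitaryLineChar_hasArchType` (file `UnitaryLineCharacters`).

KERNEL ONLY: 0 records, 0 named facts, 0 sorry. Model-construction cell pub-hodgecm, node W2-Kn.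
-/

set_option autoImplicit false

noncomputable section

open scoped Matrix
open NumberField Literature.NumberTheory.Automorphic Literature.NumberTheory.Weil1964

namespace Literature.NumberTheory.GelbartRogawski1991.UnitaryDualPair

variable (L : Type) [Field L] [NumberField L] [IsCMField L]

/-! ## §0. `det` on the CM unitary groups `U(diag d)(𝔸_{L⁺})` -/

section Det

variable {n : ℕ} (d : Fin n → L)

omit [NumberField L] [IsCMField L] in
/-- `det (diag d) = ∏ dᵢ ≠ 0`. [folklore] -/
theorem det_diagonal_ne_zero (hd0 : ∀ i, d i ≠ 0) : (Matrix.diagonal d).det ≠ 0 := by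
  rw [Matrix.det_diagonal]
  exact Finset.prod_ne_zero_iff.2 fun i _ => hd0 i

variable (hd0 : ∀ i, d i ≠ 0)

/-- **`det : U(diag d)(𝔸_{L⁺}) →* U(1)(𝔸_{L⁺})`** for the CM pair's diagonal forms. [cite: Mok2014, §1 Notation p. 5] -/
def cmAdelicDet : CMAdelic L d →* CMAdelicOne L :=
  UnitaryGroup.adelicDet (↥(maximalRealSubfield L)) L (IsCMField.complexConj L) n (Matrix.diagonal d)
    (det_diagonal_ne_zero L d hd0)

/-- underlying idele of `cmAdelicDet g` = `det g`. [folklore] -/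
@[simp] theorem coe_cmAdelicDet (g : CMAdelic L d) :
    ((cmAdelicDet L d hd0 g : CMAdelicOne L) : (AdeleRing (𝓞 L) L)ˣ) =
      Matrix.GeneralLinearGroup.det (g : GL (Fin n) (AdeleRing (𝓞 L) L)) :=
  rfl

/-- `cmAdelicDet` is continuous. [folklore] -/
theorem continuous_cmAdelicDet : Continuous (cmAdelicDet L d hd0) :=
  UnitaryGroup.continuous_adelicDet _ L _ n _ _

/-- **`det (u · 1_n) = u ^ n`** on the centre `CMCenter`. [folklore] -/
@[simp] theorem cmAdelicDet_center (u : CMAdelicOne L) : cmAdelicDet L d hd0 (CMCenter L d u) = u ^ n :=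
  UnitaryGroup.adelicDet_adelicCenter _ L _ n _ _ u

/-- rational points have principal determinant: for `γ ∈ U(diag d)(L⁺)` (i.e. `γ ∈ CMRat L d`),
`det γ` is a principal idele of `L`. [folklore] -/
theorem coe_cmAdelicDet_mem_principalIdeles {γ : CMAdelic L d} (hγ : γ ∈ CMRat L d) :
    ((cmAdelicDet L d hd0 γ : CMAdelicOne L) : (AdeleRing (𝓞 L) L)ˣ) ∈
      GaloisRepresentations.principalIdeles L := by
  obtain ⟨γ₀, rfl⟩ := hγ
  exact ⟨Matrix.GeneralLinearGroup.det (γ₀ : GL (Fin n) L),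
    (UnitaryGroup.coe_adelicDet_toAdelic _ L _ n _ _ γ₀).symm⟩

end Det

/-! ## §1. The character `(χ_V ∘ det) ⊠ (χ_W ∘ det)` and its consumer obligations -/

section Char

variable {N M : ℕ} (dV : Fin N → L) (hdV0 : ∀ i, dV i ≠ 0) (dW : Fin M → L) (hdW0 : ∀ i, dW i ≠ 0)
variable (χV χW : CMAdelicOne L →* ℂˣ)

/-- **the normalising character `η = (χ_V ∘ det_V) · (χ_W ∘ det_W)`** of `U(V)(𝔸) × U(W)(𝔸)`.
[cite: GelbartRogawski1991, §3.1 Remark p. 457 L9–13] -/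
def cmDetTwistChar : CMAdelic L dV × CMAdelic L dW →* ℂˣ :=
  (χV.comp ((cmAdelicDet L dV hdV0).comp (MonoidHom.fst _ _))) *
    (χW.comp ((cmAdelicDet L dW hdW0).comp (MonoidHom.snd _ _)))

/-- `η (g, h) = χ_V(det g) · χ_W(det h)` (definitional). [folklore] -/
@[simp] theorem cmDetTwistChar_apply (p : CMAdelic L dV × CMAdelic L dW) :
    cmDetTwistChar L dV hdV0 dW hdW0 χV χW p = χV (cmAdelicDet L dV hdV0 p.1) * χW (cmAdelicDet L dW hdW0 p.2) :=
  rfl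

/-- **`hη`**: `η` is trivial on the rational points `U(V)(L⁺) × U(W)(L⁺)` as soon as `χ_V, χ_W` are
trivial on the principal ideles inside `U(1)(𝔸_{L⁺})` (automorphy of `χ`). [folklore] -/
theorem cmDetTwistChar_eq_one_of_principal
    (hχV : ∀ u : CMAdelicOne L, (u : (AdeleRing (𝓞 L) L)ˣ) ∈ GaloisRepresentations.principalIdeles L → χV u = 1)
    (hχW : ∀ u : CMAdelicOne L, (u : (AdeleRing (𝓞 L) L)ˣ) ∈ GaloisRepresentations.principalIdeles L → χW u = 1) :
    ∀ γU ∈ CMRat L dV, ∀ γ ∈ CMRat L dW, cmDetTwistChar L dV hdV0 dW hdW0 χV χW (γU, γ) = 1 := by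
  intro γU hγU γ hγ
  rw [cmDetTwistChar_apply, hχV _ (coe_cmAdelicDet_mem_principalIdeles L dV hdV0 hγU),
    hχW _ (coe_cmAdelicDet_mem_principalIdeles L dW hdW0 hγ), one_mul]

/-- **`hηc`**: `η` is continuous (into `ℂ`) when `χ_V, χ_W` are. [folklore] -/
theorem continuous_cmDetTwistChar (hcV : Continuous χV) (hcW : Continuous χW) :
    Continuous fun p : CMAdelic L dV × CMAdelic L dW => ((cmDetTwistChar L dV hdV0 dW hdW0 χV χW p : ℂˣ) : ℂ) := by
  simp only [cmDetTwistChar_apply, Units.val_mul]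
  exact (Units.continuous_val.comp (hcV.comp ((continuous_cmAdelicDet L dV hdV0).comp continuous_fst))).mul
    (Units.continuous_val.comp (hcW.comp ((continuous_cmAdelicDet L dW hdW0).comp continuous_snd)))

/-- the central character predicted for `η = (χ_V ∘ det) ⊠ (χ_W ∘ det)` on the anti-diagonal centre:
`u ↦ χ_V(u ^ N) · χ_W(u⁻¹ ^ M)`. [folklore] -/
def cmDetCenterChar : CMAdelicOne L →* ℂˣ :=
  (χV.comp (powMonoidHom N)) * (χW.comp ((powMonoidHom M).comp invMonoidHom))

/-- `cmDetCenterChar u = χ_V(u ^ N) · χ_W(u⁻¹ ^ M)` (definitional). [folklore] -/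
@[simp] theorem cmDetCenterChar_apply (u : CMAdelicOne L) :
    cmDetCenterChar L (N := N) (M := M) χV χW u = χV (u ^ N) * χW (u⁻¹ ^ M) :=
  rfl

/-- **the centre test, PROVED for the character of record**: on `(u · 1_V, u⁻¹ · 1_W)`,
`η = χ_V(u)^N · χ_W(u)^{-M}`, i.e. `CenterCharEq L dV dW η (cmDetCenterChar L χV χW)`. So the
acceptance test `CenterCharEq η β` [HKS96 (1.14)–(1.15)] for this `η` is the identity of
`U(1)`-characters `χ_V^N · χ_W^{-M} = β`. [cite: HarrisKudlaSweet1996, (1.14)–(1.15) p. 952] -/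
theorem centerCharEq_cmDetTwistChar :
    CenterCharEq L dV dW (cmDetTwistChar L dV hdV0 dW hdW0 χV χW) (cmDetCenterChar L (N := N) (M := M) χV χW) := by
  intro u
  rw [cmDetTwistChar_apply, cmDetCenterChar_apply, cmAdelicDet_center, cmAdelicDet_center]

/-- the same as an identity of characters of `U(1)(𝔸_{L⁺})`: if `χ_V^N · χ_W^{-M} = β` then
`CenterCharEq L dV dW η β`. [folklore] -/
theorem centerCharEq_cmDetTwistChar_of_eq (β : CMAdelicOne L →* ℂˣ)
    (hβ : ∀ u : CMAdelicOne L, χV (u ^ N) * χW (u⁻¹ ^ M) = β u) :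
    CenterCharEq L dV dW (cmDetTwistChar L dV hdV0 dW hdW0 χV χW) β := fun u =>
  (centerCharEq_cmDetTwistChar L dV hdV0 dW hdW0 χV χW u).trans (hβ u)

end Char

/-! ## §2. The K-type-normalised CM representation with the character of record -/

section Model

variable {N M n : ℕ} (e : Fin N × Fin M ≃ Fin n)
  (dV : Fin N → L) (hdV : ∀ i, IsCMField.complexConj L (dV i) = dV i) (hdV0 : ∀ i, dV i ≠ 0)
  (dW : Fin M → L) (hdW : ∀ i, IsCMField.complexConj L (dW i) = dW i) (hdW0 : ∀ i, dW i ≠ 0)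
  (hGR : (cmSplittingDatum L e dV hdV hdV0 dW hdW hdW0).CompatibleSplitting)
  (χV χW : CMAdelicOne L →* ℂˣ)

/-- **`ρ_{χ_V,χ_W}(u · 1_V, u⁻¹ · 1_W) Φ = χ_V(u)^N χ_W(u)^{-M} · Φ`**: the central character of the
normalised CM representation `cmPairRepTwist hGR ((χ_V ∘ det) ⊠ (χ_W ∘ det))` on the anti-diagonal
centre. [cite: GelbartRogawski1991, §3.1 Remark p. 457 L4–13] -/
theorem cmPairRepTwist_det_center (u : CMAdelicOne L) (Φ : CMSchwartz L n) :
    cmPairRepTwist L e dV hdV hdV0 dW hdW hdW0 hGR (cmDetTwistChar L dV hdV0 dW hdW0 χV χW)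
        (CMCenter L dV u, CMCenter L dW u⁻¹) Φ =
      ((χV (u ^ N) * χW (u⁻¹ ^ M) : ℂˣ) : ℂ) • Φ :=
  cmPairRepTwist_center_of_centerCharEq L e dV hdV hdV0 dW hdW hdW0 hGR _ u
    (centerCharEq_cmDetTwistChar L dV hdV0 dW hdW0 χV χW) Φ

end Model

/-! ## §3. `χ` given on the idele-currency torus `ker N_{L/L⁺}` -/

section IdeleCurrency

variable {N M : ℕ} (dV : Fin N → L) (hdV0 : ∀ i, dV i ≠ 0) (dW : Fin M → L) (hdW0 : ∀ i, dW i ≠ 0)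
variable (ξV ξW : relNormOneIdeles (↥(maximalRealSubfield L)) L →* ℂˣ)

/-- a character of `relNormOneIdeles L⁺ L` as a character of `U(1)(𝔸_{L⁺})` in the unitary
currency (`UnitaryGroupAdelicOneTorus`). [folklore] -/
def charOfRelNormOne (ξ : relNormOneIdeles (↥(maximalRealSubfield L)) L →* ℂˣ) : CMAdelicOne L →* ℂˣ :=
  ξ.comp (UnitaryGroup.cmAdelicOneEquivRelNormOne L).toMonoidHom

/-- `charOfRelNormOne ξ u = ξ ⟨u, _⟩` with the same underlying idele. [folklore] -/
theorem charOfRelNormOne_apply (ξ : relNormOneIdeles (↥(maximalRealSubfield L)) L →* ℂˣ) (u : CMAdelicOne L) :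
    charOfRelNormOne L ξ u = ξ (UnitaryGroup.cmAdelicOneEquivRelNormOne L u) :=
  rfl

/-- automorphy transfers: `ξ` trivial on `relNormOneRat` ⇒ `charOfRelNormOne ξ` trivial on principal
ideles. [folklore] -/
theorem charOfRelNormOne_eq_one_of_principal (ξ : relNormOneIdeles (↥(maximalRealSubfield L)) L →* ℂˣ)
    (hξ : ∀ a ∈ relNormOneRat (↥(maximalRealSubfield L)) L, ξ a = 1) (u : CMAdelicOne L)
    (hu : (u : (AdeleRing (𝓞 L) L)ˣ) ∈ GaloisRepresentations.principalIdeles L) :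
    charOfRelNormOne L ξ u = 1 :=
  hξ _ ((mem_relNormOneRat_iff _ L _).2 hu)

/-- the identification `U(1)(𝔸_{L⁺}) ≃* relNormOneIdeles L⁺ L` is continuous (same underlying ideles,
both topologies induced). [folklore] -/
theorem continuous_cmAdelicOneEquivRelNormOne : Continuous (UnitaryGroup.cmAdelicOneEquivRelNormOne L) :=
  continuous_induced_rng.2 continuous_subtype_val

/-- continuity transfers. [folklore] -/
theorem continuous_charOfRelNormOne (ξ : relNormOneIdeles (↥(maximalRealSubfield L)) L →* ℂˣ)
    (hξ : Continuous ξ) : Continuous (charOfRelNormOne L ξ) :=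
  hξ.comp (continuous_cmAdelicOneEquivRelNormOne L)

/-- **the `hη` binder for the character of record from automorphic `ξ_V, ξ_W`**. [folklore] -/
theorem cmDetTwistChar_eq_one_of_relNormOneRat
    (hξV : ∀ a ∈ relNormOneRat (↥(maximalRealSubfield L)) L, ξV a = 1)
    (hξW : ∀ a ∈ relNormOneRat (↥(maximalRealSubfield L)) L, ξW a = 1) :
    ∀ γU ∈ CMRat L dV, ∀ γ ∈ CMRat L dW,
      cmDetTwistChar L dV hdV0 dW hdW0 (charOfRelNormOne L ξV) (charOfRelNormOne L ξW) (γU, γ) = 1 :=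
  cmDetTwistChar_eq_one_of_principal L dV hdV0 dW hdW0 _ _
    (charOfRelNormOne_eq_one_of_principal L ξV hξV) (charOfRelNormOne_eq_one_of_principal L ξW hξW)

end IdeleCurrency

/-! ## §4. `χ` a continuous unitary character of the automorphic quotient `[U(1)]` -/

section Quotient

variable {N M : ℕ} (dV : Fin N → L) (hdV0 : ∀ i, dV i ≠ 0) (dW : Fin M → L) (hdW0 : ∀ i, dW i ≠ 0)

/-- `Circle.toUnits : 𝕊¹ →* ℂˣ` is continuous. [folklore] -/
theorem continuous_circleToUnits : Continuous (Circle.toUnits : Circle → ℂˣ) := by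
  refine Units.continuous_iff.2 ⟨continuous_subtype_val, ?_⟩
  simp only [Circle.toUnits_apply, Units.val_inv_eq_inv_val, Units.val_mk0]
  exact continuous_subtype_val.inv₀ fun x => Circle.coe_ne_zero x

/-- **a continuous unitary character `χ` of `[U(1)] = U(1)(L⁺)\U(1)(𝔸_{L⁺})`** (quotient currency
`relNormOneIdeles L⁺ L ⧸ relNormOneRat L⁺ L`, as produced by `exists_unitaryLineChar_hasArchType`) as a
`ℂˣ`-valued character of `U(1)(𝔸_{L⁺})` in the unitary currency. [folklore] -/
def charOfUnitaryLineChar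
    (χ : ContinuousMonoidHom (relNormOneIdeles (↥(maximalRealSubfield L)) L ⧸
      relNormOneRat (↥(maximalRealSubfield L)) L) Circle) : CMAdelicOne L →* ℂˣ :=
  Circle.toUnits.comp
    (((χ : _ →* Circle).comp (QuotientGroup.mk' (relNormOneRat (↥(maximalRealSubfield L)) L))).comp
      (UnitaryGroup.cmAdelicOneEquivRelNormOne L).toMonoidHom)

/-- `charOfUnitaryLineChar χ u = χ [u]` (definitional). [folklore] -/
theorem charOfUnitaryLineChar_apply
    (χ : ContinuousMonoidHom (relNormOneIdeles (↥(maximalRealSubfield L)) L ⧸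
      relNormOneRat (↥(maximalRealSubfield L)) L) Circle) (u : CMAdelicOne L) :
    charOfUnitaryLineChar L χ u =
      Circle.toUnits (χ (QuotientGroup.mk (UnitaryGroup.cmAdelicOneEquivRelNormOne L u))) :=
  rfl

/-- **automorphy is automatic**: `charOfUnitaryLineChar χ` is trivial on principal ideles. [folklore] -/
theorem charOfUnitaryLineChar_eq_one_of_principal
    (χ : ContinuousMonoidHom (relNormOneIdeles (↥(maximalRealSubfield L)) L ⧸
      relNormOneRat (↥(maximalRealSubfield L)) L) Circle) (u : CMAdelicOne L)
    (hu : (u : (AdeleRing (𝓞 L) L)ˣ) ∈ GaloisRepresentations.principalIdeles L) :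
    charOfUnitaryLineChar L χ u = 1 := by
  rw [charOfUnitaryLineChar_apply, (QuotientGroup.eq_one_iff _).2 ((mem_relNormOneRat_iff _ L _).2 hu),
    map_one, map_one]

/-- **continuity is automatic**. [folklore] -/
theorem continuous_charOfUnitaryLineChar
    (χ : ContinuousMonoidHom (relNormOneIdeles (↥(maximalRealSubfield L)) L ⧸
      relNormOneRat (↥(maximalRealSubfield L)) L) Circle) : Continuous (charOfUnitaryLineChar L χ) :=
  continuous_circleToUnits.comp (χ.continuous.comp
    (QuotientGroup.continuous_mk.comp (continuous_cmAdelicOneEquivRelNormOne L)))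

/-- **the `hη` binder for the character of record from two unitary line characters** `χ_V, χ_W` of
`[U(1)]`. [folklore] -/
theorem cmDetTwistChar_eq_one_of_unitaryLineChar
    (χV χW : ContinuousMonoidHom (relNormOneIdeles (↥(maximalRealSubfield L)) L ⧸
      relNormOneRat (↥(maximalRealSubfield L)) L) Circle) :
    ∀ γU ∈ CMRat L dV, ∀ γ ∈ CMRat L dW,
      cmDetTwistChar L dV hdV0 dW hdW0 (charOfUnitaryLineChar L χV) (charOfUnitaryLineChar L χW) (γU, γ) = 1 :=
  cmDetTwistChar_eq_one_of_principal L dV hdV0 dW hdW0 _ _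
    (charOfUnitaryLineChar_eq_one_of_principal L χV) (charOfUnitaryLineChar_eq_one_of_principal L χW)

/-- **the `hηc` binder for the character of record from two unitary line characters**. [folklore] -/
theorem continuous_cmDetTwistChar_of_unitaryLineChar
    (χV χW : ContinuousMonoidHom (relNormOneIdeles (↥(maximalRealSubfield L)) L ⧸
      relNormOneRat (↥(maximalRealSubfield L)) L) Circle) :
    Continuous fun p : CMAdelic L dV × CMAdelic L dW =>
      ((cmDetTwistChar L dV hdV0 dW hdW0 (charOfUnitaryLineChar L χV) (charOfUnitaryLineChar L χW) p : ℂˣ) : ℂ) :=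
  continuous_cmDetTwistChar L dV hdV0 dW hdW0 _ _
    (continuous_charOfUnitaryLineChar L χV) (continuous_charOfUnitaryLineChar L χW)

end Quotient

/-! ### Build-lane note (ops-buildfix G11b-3 recipe, LEDGER B13-1, 2026-08-21)
`lean -o` (the hub build lane, never `lean`/the gate check) runs Lean 4.32's library-suggestion indexers
(`Lean.LibrarySuggestions.SymbolFrequency` / `SineQuaNon`, from their `exportEntriesFn`) over the statement of
every local theorem that is not a denied premise; on this family's statements (very large dependent binder
telescopes through the theta-kernel / dual-pair data) that fold runs for tens of minutes to hours and the build
lane kills the job (incident G11b-3, run/shared/lean/ops/buildfix/G11b-3-DOSSIER.md). `isDeniedPremise` skips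
`[implicit_reducible]` constants before any fold, and a reducibility status on a *theorem* is inert (Meta never
unfolds `thmInfo`; the kernel ignores the attribute), so the public theorems of this file are tagged
`[implicit_reducible]` purely to keep them out of that index. Only other effect: they are not offered by
`+suggestions` premise selectors. No statement or proof is changed; superseded if the operator lands a
deny-list form (`HarnessLib.PremiseIndex`). -/
set_option allowUnsafeReducibility true in
attribute [implicit_reducible]
  det_diagonal_ne_zero coe_cmAdelicDet continuous_cmAdelicDet cmAdelicDet_center
  coe_cmAdelicDet_mem_principalIdeles cmDetTwistChar_apply cmDetTwistChar_eq_one_of_principal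
  continuous_cmDetTwistChar cmDetCenterChar_apply centerCharEq_cmDetTwistChar
  centerCharEq_cmDetTwistChar_of_eq cmPairRepTwist_det_center charOfRelNormOne_apply
  charOfRelNormOne_eq_one_of_principal continuous_cmAdelicOneEquivRelNormOne
  continuous_charOfRelNormOne cmDetTwistChar_eq_one_of_relNormOneRat continuous_circleToUnits
  charOfUnitaryLineChar_apply charOfUnitaryLineChar_eq_one_of_principal
  continuous_charOfUnitaryLineChar cmDetTwistChar_eq_one_of_unitaryLineChar
  continuous_cmDetTwistChar_of_unitaryLineChar

end Literature.NumberTheory.GelbartRogawski1991.UnitaryDualPair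

end
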